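import Summits.Ventures.YMGap.RobustBall.PerturbedAxisCovariance
import Summits.Ventures.YMGap.RobustBall.WilsonOneStateSymmetry
import Summits.QuantumFields.GaugeBoot.ClassBLimitSymmetry
import Literature.MathematicalPhysics.QuantumFieldTheory.StrongCouplingActivities
import HarnessLib

/-!
# Venture YMGap, track ROBUST-BALL — ONE STATE, step 14: covariance of the perturbed specifications under the AXIS
# REFLECTIONS `x_i ↦ −x_i`; the one state of a reflection-symmetric member is reflection symmetric; Wilson: the
# one state carries the full hyperoctahedral symmetry

HONEST FRAMING. WHAT THIS IS: a venture file (cell `pub-ymgap`, track Y2 ROBUST-BALL, seat ds-3, theorems only), the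
reflection twin of `PerturbedCovariance.lean` (translations) and `PerturbedAxisCovariance.lean` (axis permutations), on
the DLR side. A reflection reverses the orientation of the links in its own direction, so the induced map of
configurations is the gauge-boot cell's `configSiteReflect i` (`U ↦ (x ↦ U(𝓻x))` on links across the mirror direction,
`U ↦ (x ↦ U(𝓻x)⁻¹)` on links along it). GENERIC: for ANY measurable bijection `T` of configuration space of the form
`(T U)(x) = φ_x (U (e⁻¹ x))` — a relabelling `e` of the links TWISTED by Haar-preserving bijections `φ_x` of the group —
tilted product-Haar kernels with a `T`-covariant energy are `T`-covariant (`Covariance.tilted_glueWith_map_twist`: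
product Haar is invariant under the twist, Mathlib `measurePreserving_pi`; inversion invariance of Haar on a compact group,
tree `haarProbability.instIsInvInvariant`) and covariant kernels have a `T`-stable DLR set (`Covariance.map_equiv_mem_gibbsMeasures`).
REFLECTIONS: the reflected plaquette holonomy is the holonomy of the reflected plaquette or a conjugate of its inverse
(`plaquetteHolonomyZd_configSiteReflect_*`; `Re tr ρ(g⁻¹) = Re tr ρ(g)` for compact `G`, tree `re_trace_map_inv`), so
the boundary WILSON ACTION on `ℤ^d` IS REFLECTION COVARIANT (`wilsonBoundaryAction_reflect`). The companion file
`OneStateReflection.lean` draws the consequences: reflection covariance of the tier-1 perturbed specification, the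
reflection-invariant one state of reflection-symmetric members, and the full hyperoctahedral symmetry of the Wilson one
state. WHAT THIS IS NOT: reflection POSITIVITY is not touched; lattice statements only, nothing about the
continuum limit or the Clay Millennium problem.

References: H.-O. Georgii (2011), §5.1; E. Seiler, LNP 159 (1982), Ch. 1–2; the gauge-boot cell's `ClassB.lean`,
`ClassBLimitSymmetry.lean`; the track's `PerturbedAxisCovariance.lean`, `WilsonOneStateSymmetry.lean`.
-/

noncomputable section

open MeasureTheory Filter Function
open Literature.Probability.LatticeModels hiding configShift configShift_apply
open Literature.MathematicalPhysics.QuantumLattice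
open Literature.MathematicalPhysics.QuantumFieldTheory hiding ZdEdge Site
open Summit.QuantumFields.GaugeBoot (zdSiteReflect configSiteReflect configSiteReflect_apply zdSiteReflect_zdSiteReflect
  zdSiteReflect_sub_single configSiteReflect_configSiteReflect measurable_configSiteReflect)

namespace Summit.Ventures.YMGap.RobustBall

namespace Covariance

/-! ### Generic: DLR stability and tilted-kernel covariance under a twisted relabelling -/

section Equiv

variable {d : ℕ} {G : Type*} [MeasurableSpace G]

/-- **Covariant kernels under a measurable bijection of configuration space ⇒ the image of a Gibbs measure is a Gibbs
measure** (Georgii 2011, §5.1): if `γ_Λ(· | η) ∘ T⁻¹ = γ_{eΛ}(· | T η)` for a relabelling `e` of the volumes, then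
`μ ∈ 𝒢(γ) ⇒ μ ∘ T⁻¹ ∈ 𝒢(γ)`. [folklore] -/
theorem map_equiv_mem_gibbsMeasures {γ : Specification (ZdEdge d) G} (hγ : IsSpecification γ)
    (T : LGConfig d G ≃ᵐ LGConfig d G) (e : ZdEdge d ≃ ZdEdge d)
    (hcov : ∀ (Λ : Finset (ZdEdge d)) (η : LGConfig d G), (γ Λ η).map T = γ (Λ.map e.toEmbedding) (T η))
    {μ : Measure (LGConfig d G)} (hμ : μ ∈ gibbsMeasures γ) : μ.map T ∈ gibbsMeasures γ := by
  rw [mem_gibbsMeasures_iff] at hμ ⊢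
  haveI := hμ.isProbabilityMeasure
  refine ⟨Measure.isProbabilityMeasure_map T.measurable.aemeasurable, fun Λ' A hA => ?_⟩
  set Λ : Finset (ZdEdge d) := Λ'.map e.symm.toEmbedding with hΛ
  have hΛ' : Λ' = Λ.map e.toEmbedding := (map_symm_map e Λ').symm
  rw [lintegral_map (hγ.measurable_coe Λ' hA) T.measurable, Measure.map_apply T.measurable hA]
  have hpt : ∀ η : LGConfig d G, γ Λ' (T η) A = γ Λ η (T ⁻¹' A) := fun η => by
    rw [hΛ', ← hcov Λ η, Measure.map_apply T.measurable hA]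
  simp_rw [hpt]
  exact hμ.2 Λ _ (T.measurable hA)

end Equiv

section Twist

variable {d : ℕ} {G : Type*} [Group G] [TopologicalSpace G] [IsTopologicalGroup G] [CompactSpace G]
  [MeasurableSpace G] [BorelSpace G] [SecondCountableTopology G]

/-- **Covariance of tilted product-Haar kernels under a TWISTED relabelling of the links (integral form)**: for a
measurable bijection `T` with `(T U)(x) = φ_x (U (e⁻¹ x))`, every `φ_x` preserving the Haar probability measure, and
energies with `ψ' (T U) = ψ U`: `∫ F dγ^{ψ'}_{eΛ}(· | T η) = ∫ F ∘ T dγ^{ψ}_Λ(· | η)` — the product Haar measure on `G^Λ`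
is carried to the product Haar measure on `G^{eΛ}` by the twist (Mathlib `measurePreserving_pi`,
`measurePreserving_piCongrLeft`), and gluing commutes with `T`. [folklore] -/
theorem integral_tilted_glueWith_twist (ψ ψ' : LGConfig d G → ℝ) (hψc : Continuous ψ) (hψc' : Continuous ψ')
    (Λ : Finset (ZdEdge d)) (T : LGConfig d G ≃ᵐ LGConfig d G) (e : ZdEdge d ≃ ZdEdge d) (φ : ZdEdge d → G ≃ᵐ G)
    (hT : ∀ U x, T U x = φ x (U (e.symm x)))
    (hφ : ∀ x, MeasurePreserving (φ x) (haarProbability G) (haarProbability G))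
    (hcov : ∀ U, ψ' (T U) = ψ U) {F : LGConfig d G → ℝ} (hF : Measurable F) (η : LGConfig d G) :
    ∫ U, F U ∂(((Measure.pi fun _ : ↥(Λ.map e.toEmbedding) => haarProbability G).map
        (glueWith (Λ.map e.toEmbedding) · (T η))).tilted ψ') =
      ∫ U, F (T U) ∂(((Measure.pi fun _ : ↥Λ => haarProbability G).map (glueWith Λ · η)).tilted ψ) := by
  set Λ' := Λ.map e.toEmbedding with hΛ'
  set eΛ : ↥Λ ≃ ↥Λ' := e.subtypeEquiv fun _ => (Finset.mem_map' e.toEmbedding).symm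
  set Ψ₀ : (↥Λ → G) ≃ᵐ (↥Λ' → G) := MeasurableEquiv.piCongrLeft (fun _ => G) eΛ
  set Q : (↥Λ → G) ≃ᵐ (↥Λ → G) := MeasurableEquiv.piCongrRight fun x : ↥Λ => (φ (e x)).symm
  set Ψ : (↥Λ' → G) ≃ᵐ (↥Λ → G) := Ψ₀.symm.trans Q
  have hQm : MeasurePreserving Q (Measure.pi fun _ : ↥Λ => haarProbability G)
      (Measure.pi fun _ : ↥Λ => haarProbability G) :=
    measurePreserving_pi (fun _ : ↥Λ => haarProbability G) (fun _ : ↥Λ => haarProbability G)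
      (f := fun x g => (φ (e x)).symm g) fun x => (hφ (e x)).symm (φ (e x))
  have hΨ₀m : MeasurePreserving Ψ₀.symm (Measure.pi fun _ : ↥Λ' => haarProbability G)
      (Measure.pi fun _ : ↥Λ => haarProbability G) :=
    (measurePreserving_piCongrLeft (fun _ : ↥Λ' => haarProbability G) eΛ).symm Ψ₀
  have hΨm : MeasurePreserving Ψ (Measure.pi fun _ : ↥Λ' => haarProbability G)
      (Measure.pi fun _ : ↥Λ => haarProbability G) := hQm.comp hΨ₀m
  have hΨapply : ∀ (ζ' : ↥Λ' → G) (x : ↥Λ), Ψ ζ' x = (φ (e x)).symm (ζ' (eΛ x)) := fun ζ' x => rfl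
  -- gluing commutes with `T`
  have hglue : ∀ ζ' : ↥Λ' → G, T (glueWith Λ (Ψ ζ') η) = glueWith Λ' ζ' (T η) := by
    intro ζ'
    funext x'
    rw [hT]
    by_cases h' : x' ∈ Λ'
    · have h₀ : e.symm x' ∈ Λ := by rwa [hΛ', Finset.mem_map_equiv] at h'
      rw [glueWith_apply_mem _ _ _ h₀, glueWith_apply_mem _ _ _ h', hΨapply]
      have hex : eΛ ⟨e.symm x', h₀⟩ = ⟨x', h'⟩ := Subtype.ext (e.apply_symm_apply x')
      rw [hex]
      have hee : (e (⟨e.symm x', h₀⟩ : ↥Λ) : ZdEdge d) = x' := e.apply_symm_apply x'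
      simp only [hee, MeasurableEquiv.apply_symm_apply]
    · have h₀ : e.symm x' ∉ Λ := fun h => h' (by rw [hΛ', Finset.mem_map_equiv]; exact h)
      rw [glueWith_apply_not_mem _ _ _ h₀, glueWith_apply_not_mem _ _ _ h', hT]
  have hS : ∀ ζ' : ↥Λ' → G, ψ (glueWith Λ (Ψ ζ') η) = ψ' (glueWith Λ' ζ' (T η)) := fun ζ' => by
    rw [← hglue]
    exact (hcov _).symm
  rw [integral_tilted_glueWith ψ' hψc' Λ' hF,
    integral_tilted_glueWith ψ hψc Λ (F := fun U => F (T U)) (hF.comp T.measurable),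
    ← hΨm.integral_comp', ← hΨm.integral_comp']
  simp only [hglue, hS]

/-- **Covariance of tilted product-Haar kernels under a twisted relabelling (push-forward form)**:
`γ^{ψ}_Λ(· | η) ∘ T⁻¹ = γ^{ψ'}_{eΛ}(· | T η)`. [folklore] -/
theorem tilted_glueWith_map_twist (ψ ψ' : LGConfig d G → ℝ) (hψc : Continuous ψ) (hψc' : Continuous ψ')
    (Λ : Finset (ZdEdge d)) (T : LGConfig d G ≃ᵐ LGConfig d G) (e : ZdEdge d ≃ ZdEdge d) (φ : ZdEdge d → G ≃ᵐ G)
    (hT : ∀ U x, T U x = φ x (U (e.symm x)))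
    (hφ : ∀ x, MeasurePreserving (φ x) (haarProbability G) (haarProbability G))
    (hcov : ∀ U, ψ' (T U) = ψ U) (η : LGConfig d G) :
    (((Measure.pi fun _ : ↥Λ => haarProbability G).map (glueWith Λ · η)).tilted ψ).map T =
      ((Measure.pi fun _ : ↥(Λ.map e.toEmbedding) => haarProbability G).map
        (glueWith (Λ.map e.toEmbedding) · (T η))).tilted ψ' := by
  set Λ' := Λ.map e.toEmbedding with hΛ'
  haveI h1 : IsProbabilityMeasure (((Measure.pi fun _ : ↥Λ => haarProbability G).map (glueWith Λ · η)).tilted ψ) :=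
    isProbabilityMeasure_tilted_map_glueWith_pi (V := ZdEdge d) (haarProbability G) Λ η hψc.measurable
      (exists_bound_of_continuous hψc)
  haveI h2 : IsProbabilityMeasure (((Measure.pi fun _ : ↥Λ' => haarProbability G).map
      (glueWith Λ' · (T η))).tilted ψ') :=
    isProbabilityMeasure_tilted_map_glueWith_pi (V := ZdEdge d) (haarProbability G) Λ' (T η)
      hψc'.measurable (exists_bound_of_continuous hψc')
  haveI : IsProbabilityMeasure ((((Measure.pi fun _ : ↥Λ => haarProbability G).map (glueWith Λ · η)).tilted ψ).map T) :=
    Measure.isProbabilityMeasure_map T.measurable.aemeasurable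
  ext A hA
  have hind : Measurable (A.indicator (1 : LGConfig d G → ℝ)) := measurable_one.indicator hA
  have h1' : ((((Measure.pi fun _ : ↥Λ => haarProbability G).map (glueWith Λ · η)).tilted ψ).map T).real A =
      (((Measure.pi fun _ : ↥Λ' => haarProbability G).map (glueWith Λ' · (T η))).tilted ψ').real A := by
    rw [← integral_indicator_one hA, ← integral_indicator_one hA, integral_map_equiv,
      integral_tilted_glueWith_twist ψ ψ' hψc hψc' Λ T e φ hT hφ hcov hind η]
  rw [measureReal_def, measureReal_def, ENNReal.toReal_eq_toReal_iff' (measure_ne_top _ _)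
    (measure_ne_top _ _)] at h1'
  exact h1'

end Twist

end Covariance

/-! ### The reflection of `ℤ^d`: sites, links, plaquettes -/

section Geometry

variable {d : ℕ}

/-- The site reflection is additive. [folklore] -/
theorem zdSiteReflect_add (i : Fin d) (x y : Site d) : zdSiteReflect i (x + y) = zdSiteReflect i x + zdSiteReflect i y := by
  ext k
  by_cases hk : k = i
  · subst hk; simp [zdSiteReflect]; ring
  · simp [zdSiteReflect, hk]

/-- The site reflection negates the unit vector of its own direction. [folklore] -/
theorem zdSiteReflect_single_self (i : Fin d) : zdSiteReflect i (Pi.single i (1 : ℤ)) = -Pi.single i 1 := by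
  ext k
  by_cases hk : k = i
  · subst hk; simp [zdSiteReflect]
  · simp [zdSiteReflect, hk]

/-- The site reflection fixes the unit vectors of the other directions. [folklore] -/
theorem zdSiteReflect_single_of_ne {i k : Fin d} (h : k ≠ i) : zdSiteReflect i (Pi.single k (1 : ℤ)) = Pi.single k 1 := by
  ext m
  by_cases hm : m = i
  · subst hm; simp [zdSiteReflect, Ne.symm h]
  · simp [zdSiteReflect, hm]

/-- The reflection of links is an involution. [folklore] -/
theorem reflectEdge_involutive (i : Fin d) :
    Function.Involutive (fun x : ZdEdge d =>
      if x.2 = i then (zdSiteReflect i x.1 - Pi.single i 1, i) else (zdSiteReflect i x.1, x.2)) := by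
  rintro ⟨x, k⟩
  by_cases hk : k = i
  · subst hk
    simp only [↓reduceIte, zdSiteReflect_sub_single, zdSiteReflect_zdSiteReflect, add_sub_cancel_right]
  · simp only [hk, ↓reduceIte, zdSiteReflect_zdSiteReflect]

variable {G : Type*} [Group G]

/-- **Reflected plaquette holonomy, plane across the mirror direction**: for `a, b ≠ i` the holonomy of the reflected
configuration around `(x; a, b)` is the holonomy around the mirror plaquette `(𝓻x; a, b)`. [folklore] -/
theorem plaquetteHolonomyZd_configSiteReflect_of_ne {i a b : Fin d} (ha : a ≠ i) (hb : b ≠ i) (U : LGConfig d G)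
    (x : Site d) :
    plaquetteHolonomyZd (configSiteReflect i U) x a b = plaquetteHolonomyZd U (zdSiteReflect i x) a b := by
  simp only [plaquetteHolonomyZd, configSiteReflect_apply, ha, hb, ↓reduceIte, zdSiteReflect_add,
    zdSiteReflect_single_of_ne ha, zdSiteReflect_single_of_ne hb]

/-- **Reflected plaquette holonomy, first direction along the mirror direction**: for `b ≠ i` the holonomy of the
reflected configuration around `(x; i, b)` is the conjugate by `U(z, i)⁻¹` of the INVERSE holonomy around the
plaquette `(z; i, b)`, `z = 𝓻x − e_i`. [folklore] -/
theorem plaquetteHolonomyZd_configSiteReflect_fst {i b : Fin d} (hb : b ≠ i) (U : LGConfig d G) (x : Site d) :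
    plaquetteHolonomyZd (configSiteReflect i U) x i b =
      (U (zdSiteReflect i x - Pi.single i 1, i))⁻¹ *
        (plaquetteHolonomyZd U (zdSiteReflect i x - Pi.single i 1) i b)⁻¹ * ((U (zdSiteReflect i x - Pi.single i 1, i))⁻¹)⁻¹ := by
  have e1 : zdSiteReflect i x + Pi.single b 1 - Pi.single i 1 = zdSiteReflect i x - Pi.single i 1 + Pi.single b 1 := by abel
  have e2 : zdSiteReflect i x + -Pi.single i (1 : ℤ) = zdSiteReflect i x - Pi.single i 1 := by abel
  have e3 : zdSiteReflect i x = zdSiteReflect i x - Pi.single i 1 + Pi.single i 1 := by abel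
  simp only [plaquetteHolonomyZd, configSiteReflect_apply, hb, ↓reduceIte, zdSiteReflect_add,
    zdSiteReflect_single_of_ne hb, zdSiteReflect_single_self, e1, e2]
  conv_lhs => rw [e3]
  simp only [add_sub_cancel_right]
  group

/-- **Reflected plaquette holonomy, second direction along the mirror direction**: for `a ≠ i` the holonomy of the
reflected configuration around `(x; a, i)` is the conjugate by `U(z, i)⁻¹` of the INVERSE holonomy around `(z; a, i)`,
`z = 𝓻x − e_i`. [folklore] -/
theorem plaquetteHolonomyZd_configSiteReflect_snd {i a : Fin d} (ha : a ≠ i) (U : LGConfig d G) (x : Site d) :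
    plaquetteHolonomyZd (configSiteReflect i U) x a i =
      (U (zdSiteReflect i x - Pi.single i 1, i))⁻¹ *
        (plaquetteHolonomyZd U (zdSiteReflect i x - Pi.single i 1) a i)⁻¹ * ((U (zdSiteReflect i x - Pi.single i 1, i))⁻¹)⁻¹ := by
  have e1 : zdSiteReflect i x + Pi.single a 1 - Pi.single i 1 = zdSiteReflect i x - Pi.single i 1 + Pi.single a 1 := by abel
  have e2 : zdSiteReflect i x + -Pi.single i (1 : ℤ) = zdSiteReflect i x - Pi.single i 1 := by abel
  have e3 : zdSiteReflect i x = zdSiteReflect i x - Pi.single i 1 + Pi.single i 1 := by abel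
  simp only [plaquetteHolonomyZd, configSiteReflect_apply, ha, ↓reduceIte, zdSiteReflect_add,
    zdSiteReflect_single_of_ne ha, zdSiteReflect_single_self, e1, e2]
  conv_lhs => rw [e3]
  simp only [add_sub_cancel_right]
  group

variable {N : ℕ} [TopologicalSpace G] [IsTopologicalGroup G] [CompactSpace G] (ρ : G →* Matrix (Fin N) (Fin N) ℂ)

/-- **A reflected plaquette is a plaquette with the same observable**: for every plaquette `p` there is a plaquette
`p'` (its mirror image, shifted one step down along the mirror direction when `p` lies in a plane containing that
direction) with links `𝓻 '' links(p)` and `Re tr ρ(U'_{p'}) = Re tr ρ(U_p)` for `U' = configSiteReflect i U`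
(`Re tr ρ(h g⁻¹ h⁻¹) = Re tr ρ(g)`, tree `trace_conj_eq`, `re_trace_map_inv`). [folklore] -/
theorem exists_plaquette_reflect (hρ : Continuous ρ) (i : Fin d) (p : ZdPlaquette d) :
    ∃ p' : ZdPlaquette d,
      plaquetteEdges p' = (plaquetteEdges p).image (fun x : ZdEdge d =>
        if x.2 = i then (zdSiteReflect i x.1 - Pi.single i 1, i) else (zdSiteReflect i x.1, x.2)) ∧
      ∀ U : LGConfig d G, plaquetteObs ρ p'.1 p'.2.1.1 p'.2.1.2 (configSiteReflect i U) =
        plaquetteObs ρ p.1 p.2.1.1 p.2.1.2 U := by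
  classical
  obtain ⟨y, ⟨⟨a, b⟩, hab⟩⟩ := p
  have hab' : a < b := hab
  have hz : zdSiteReflect i (zdSiteReflect i y - Pi.single i 1) - Pi.single i 1 = y := by
    rw [zdSiteReflect_sub_single, zdSiteReflect_zdSiteReflect, add_sub_cancel_right]
  have e1 : zdSiteReflect i y + -Pi.single i (1 : ℤ) = zdSiteReflect i y - Pi.single i 1 := by abel
  have e3 : zdSiteReflect i y = zdSiteReflect i y - Pi.single i 1 + Pi.single i 1 := by abel
  by_cases ha : a = i
  · subst ha
    have hb : b ≠ a := hab'.ne'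
    refine ⟨(zdSiteReflect a y - Pi.single a 1, ⟨(a, b), hab⟩), ?_, fun U => ?_⟩
    · have e2 : zdSiteReflect a y + Pi.single b 1 - Pi.single a 1 = zdSiteReflect a y - Pi.single a 1 + Pi.single b 1 := by
        abel
      ext z
      simp only [plaquetteEdges, Finset.image_insert, Finset.image_singleton, Finset.mem_insert, Finset.mem_singleton,
        hb, ↓reduceIte, zdSiteReflect_add, zdSiteReflect_single_self, zdSiteReflect_single_of_ne hb, e1, e2]
      conv_rhs => rw [e3]
      simp only [add_sub_cancel_right]
      tauto
    · simp only [plaquetteObs]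
      rw [plaquetteHolonomyZd_configSiteReflect_fst hb, hz,
        Literature.RepresentationTheory.CompactGroups.CompactGroup.trace_conj_eq,
        Literature.RepresentationTheory.CompactGroups.CompactGroup.re_trace_map_inv ρ hρ]
  by_cases hb : b = i
  · subst hb
    refine ⟨(zdSiteReflect b y - Pi.single b 1, ⟨(a, b), hab⟩), ?_, fun U => ?_⟩
    · have e2 : zdSiteReflect b y + Pi.single a 1 - Pi.single b 1 = zdSiteReflect b y - Pi.single b 1 + Pi.single a 1 := by
        abel
      ext z
      simp only [plaquetteEdges, Finset.image_insert, Finset.image_singleton, Finset.mem_insert, Finset.mem_singleton,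
        ha, ↓reduceIte, zdSiteReflect_add, zdSiteReflect_single_self, zdSiteReflect_single_of_ne ha, e1, e2]
      conv_rhs => rw [e3]
      simp only [add_sub_cancel_right]
      tauto
    · simp only [plaquetteObs]
      rw [plaquetteHolonomyZd_configSiteReflect_snd ha, hz,
        Literature.RepresentationTheory.CompactGroups.CompactGroup.trace_conj_eq,
        Literature.RepresentationTheory.CompactGroups.CompactGroup.re_trace_map_inv ρ hρ]
  · refine ⟨(zdSiteReflect i y, ⟨(a, b), hab⟩), ?_, fun U => ?_⟩
    · simp only [plaquetteEdges, Finset.image_insert, Finset.image_singleton, ha, hb, ↓reduceIte, zdSiteReflect_add,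
        zdSiteReflect_single_of_ne ha, zdSiteReflect_single_of_ne hb]
    · simp only [plaquetteObs, plaquetteHolonomyZd_configSiteReflect_of_ne ha hb, zdSiteReflect_zdSiteReflect]

/-- **The boundary Wilson action on `ℤ^d` is covariant under the axis reflections**: `S_{𝓻Λ}(configSiteReflect i U) = S_Λ(U)`
(re-index the plaquettes by `exists_plaquette_reflect`; a plaquette is determined by its links). [folklore] -/
theorem wilsonBoundaryAction_reflect (hρ : Continuous ρ) (i : Fin d) (Λ : Finset (ZdEdge d)) (U : LGConfig d G) :
    wilsonBoundaryAction ρ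
        (Λ.image (fun x : ZdEdge d =>
        if x.2 = i then (zdSiteReflect i x.1 - Pi.single i 1, i) else (zdSiteReflect i x.1, x.2)))
        (configSiteReflect i U) = wilsonBoundaryAction ρ Λ U := by
  classical
  choose f hf hfo using exists_plaquette_reflect ρ hρ i
  have hinv := reflectEdge_involutive (d := d) i
  have hff : ∀ p, f (f p) = p := fun p =>
    plaquetteEdges_injective (by rw [hf, hf, Finset.image_image, hinv.comp_self, Finset.image_id])
  have hmem : ∀ p, p ∈ plaquettesTouching Λ ↔
      f p ∈ plaquettesTouching (Λ.image (fun x : ZdEdge d =>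
        if x.2 = i then (zdSiteReflect i x.1 - Pi.single i 1, i) else (zdSiteReflect i x.1, x.2))) := fun p => by
    rw [mem_plaquettesTouching_iff, mem_plaquettesTouching_iff, hf, ← Finset.image_inter _ _ hinv.injective,
      Finset.image_nonempty]
  unfold wilsonBoundaryAction
  refine (Finset.sum_nbij' f f (fun p hp => (hmem p).1 hp) (fun p hp => ?_) (fun p _ => hff p) (fun p _ => hff p)
    (fun p _ => by rw [hfo])).symm
  rw [hmem, hff]
  exact hp

end Geometry

end Summit.Ventures.YMGap.RobustBall

end
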